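import Summits.BirchSwinnertonDyer.BirchSwinnertonDyer.Theorems.AlignedTransportAtTwoMainConjectureOfRankZeroBSDAtTwoCubicClosureParity
import Summits.BirchSwinnertonDyer.BirchSwinnertonDyer.Theorems.AlignedTransportAtTwoMainConjectureOfRankZeroBSDAtTwoRankCertificateLambda
import Literature.NumberTheory.IwasawaTheory.ClassNumberPExpCoprimeGaloisCongruence
import HarnessLib

/-!
# Route `AlignedTransportAtTwo`, crux C2 `MainConjectureOfRankZeroBSDAtTwo` (stmt-BirchSwinnertonDyer-22298):
# THE RESOLVENT PARITY LAW — `ord₂ h`, `rank₂ Cl` and `λ₂` of the sextic carrier `ℚ(W[2])` have the PARITY of those of the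
# resolvent quadratic field `ℚ(√Δ_W) = ℚ(W[2])^{C₃}`, at every layer of the cyclotomic `ℤ₂`-towers

HONEST FRAMING (cell `bsd-f1-sign2`, WIDTH-5 attached prover seat `bsd-line-att-p3` gen 29, line `birth`, lead `bsd-line-att-p2`; `--supports`
stmt-BirchSwinnertonDyer-22298, closes nothing; BSD is NOT proved by any of this; the crux C2, its verdict «blocked-on
`Rank1Residual.GreenbergMuConjectureIrreducible`» and every registered stub (P / T / Kμ / LimDoor / MuIneqʳ / PFμ⁺) are untouched).  THEOREMS ONLY —
no definition, no named fact, no `sorry`; nothing here is conditional on a named fact.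

THE LAW.  For EVERY elliptic `W/ℚ` with `Δ_W ∉ ℚ²` and `δ ∈ ℚ̄` with `δ² = Δ_W`, the `2`-division field `T = ℚ(W[2]) ⊆ ℚ̄` contains `ℚ(δ)` and is Galois over
it of degree dividing `3` (tree: `rootSet_subset_divisionField`, `16 δ₀² = Δ`, `[ℚ(W[2]) : ℚ] ∣ 6`; att-p5 g27 `…CubicClosureParity`), so its group is a
`3`-group; `2 ≡ −1 (mod 3)`.  This seat's Literature bricks `NumberFields/ClassGroupCoprimeGaloisDescentCongruence` (`#Cl(T)[2^k]^{C₃} = #Cl(ℚ(δ))[2^k]`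
by Neukirch III (1.6) + orbit counting of the `3`-group on `Cl(T)[2^k]`: `2^{ord₂ h(T)} ≡ 2^{ord₂ h(ℚ(δ))} (mod 3)`) and
`IwasawaTheory/ClassNumberPExpCoprimeGaloisCongruence` (the same along the layers `T·ℚ_n ⊇ ℚ(δ)·ℚ_n` of the `ℤ₂`-towers) give:

* §1 `adjoin_le_divisionField_two_of_sq_eq` (`ℚ(δ) ≤ ℚ(W[2])`), `finrank_divisionField_two_dvd_three_of_sq_eq` (`[ℚ(W[2]) : ℚ(δ)] ∣ 3`).
* §2 layer `0` (plain number fields, the `-data` consistency check): ★ `padicValNat_two_card_classGroup_divisionField_two_modEq_two`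
  (**`ord₂ h(ℚ(W[2])) ≡ ord₂ h(ℚ(√Δ_W)) (mod 2)`**, with `≤`), ★ `rankTwo_classGroup_divisionField_two_modEq_two`
  (**`rank₂ Cl(ℚ(W[2])) ≡ rank₂ Cl(ℚ(√Δ_W)) (mod 2)`**, with `≤`; the right side is Gauss's genus number `t − 1` of the quadratic field).
* §3 towers (`κ`, `κT` ANY cyclotomic `ℤ₂`-extensions of `ℚ(δ)`, `ℚ(W[2])`): ★ `classNumberPExp_divisionField_two_modEq_two_resolvent`
  (**`e_n(ℚ(W[2])) ≡ e_n(ℚ(√Δ_W)) (mod 2)`** and `≤`, every `n`), ★ `classGroupPRank_divisionField_two_modEq_two_resolvent`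
  (**`rank₂ Cl(ℚ(W[2])_n) ≡ rank₂ Cl(ℚ(√Δ_W)_n) (mod 2)`** and `≤`), ★ `classicalLambda_divisionField_two_modEq_two_resolvent`
  (**`μ₂(ℚ(W[2])) = 0 ⟹ μ₂(ℚ(√Δ_W)) = 0 ∧ λ₂(ℚ(√Δ_W)) ≤ λ₂(ℚ(W[2])) ∧ λ₂(ℚ(W[2])) ≡ λ₂(ℚ(√Δ_W)) (mod 2)`**).
* §4 the Kilford sub-cell (`Δ_W < 0`, ON the stratum; g26 `…GreenbergFieldLambda`: `ℚ(√Δ_W)` imaginary quadratic with `2` split, `μ = 0 ⟹ λ₂ ≥ 1`; g28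
  `…RankCertificateLambda`: a rank certificate of value `r` on the sextic gives `3 ≤ λ₂(T) ≤ r`): ★ `classicalLambda_sandwich_and_parity_of_rankCert`
  (certificate ⟹ `3 ≤ λ₂(T) ≤ r`, `1 ≤ λ₂(ℚ(√Δ_W)) ≤ λ₂(T)`, `λ₂(T) ≡ λ₂(ℚ(√Δ_W)) (mod 2)`), `odd_classicalLambda_resolvent_of_rankCert_eq_three`
  (a certificate of the minimal value `3` forces `λ₂(ℚ(√Δ_W)) ∈ {1, 3}`), `classGroupPRank_succ_ne_of_even_classicalLambda_resolvent`
  (if `λ₂(ℚ(√Δ_W))` is EVEN, no certificate of value `3` exists: the first admissible value is `4`).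

WHAT THIS BUYS THE CRUX (numbers, not adjectives).  The C2 input on the Kilford sub-cell is a 2-rank certificate on the sextic `ℚ(W[2])` (value `r ≥ 3`,
`3 ≤ λ₂ ≤ r`, g27/g28).  Its PARITY BIT is now read on a QUADRATIC field: `λ₂(ℚ(W[2])) ≡ λ₂(ℚ(√Δ_W)) (mod 2)`, and `λ₂` of an imaginary quadratic field in
the cyclotomic `ℤ₂`-tower is given in closed form by Ferrero (1980) / Kida (1979) from the primes dividing `Δ_W`; likewise every census row
`rank₂ Cl(ℚ(W[2])) = r₀` must satisfy `r₀ ≡ t_Δ − 1 (mod 2)` (Gauss genus theory of `ℚ(√Δ_W)`), a zero-cost check on the `-data` tables.  No part of C2 is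
closed: the law constrains, it does not produce, the certificate.

References: [Washington1997] §10.1, Thm. 10.8, §13.1, §13.3; [NeukirchANT1999] Ch. III §1 Prop. (1.6); [Iwasawa1973MuInvariants] §3; [Ferrero1980]
B. Ferrero, *The cyclotomic ℤ₂-extension of imaginary quadratic fields*, Amer. J. Math. 102 (1980) 447–459 (the formula for `λ₂`; not held);
[Kida1979] Y. Kida, *On cyclotomic ℤ₂-extensions of imaginary quadratic fields*, Tôhoku Math. J. 31 (1979) 91–96 (not held);
[DokchitserDokchitserMathZ2012] (ℚ(E[2]) ⊃ ℚ(√Δ)); tree files cited inline.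
-/

set_option linter.dupNamespace false
set_option autoImplicit false

noncomputable section

open scoped Classical NumberField

namespace Summit.BirchSwinnertonDyer.BirchSwinnertonDyer.Theorems.AlignedTransportAtTwoResolventParity

open Polynomial WeierstrassCurve IntermediateField Field NumberField
  Literature.NumberTheory.EllipticCurves Literature.NumberTheory.EllipticCurves.Greenberg1999 Literature.NumberTheory.GaloisRepresentations
  Literature.NumberTheory.EllipticCurves.DokchitserDokchitser2012
  Literature.NumberTheory.IwasawaTheory Literature.NumberTheory.NumberFields
  Summit.BirchSwinnertonDyer.Rank1Residual.F1Sign2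
  Summit.BirchSwinnertonDyer.BirchSwinnertonDyer.Theorems.AlignedTransportAtTwoFineRoad.DivisionCubic
  Summit.BirchSwinnertonDyer.BirchSwinnertonDyer.Theorems.AlignedTransportAtTwoFineRoad.TowerImageDelta
  Summit.BirchSwinnertonDyer.BirchSwinnertonDyer.Theorems.AlignedTransportAtTwoCubicClosureParity
  Summit.BirchSwinnertonDyer.BirchSwinnertonDyer.Theorems.AlignedTransportAtTwoGreenbergFieldLambda
  Summit.BirchSwinnertonDyer.BirchSwinnertonDyer.Theorems.AlignedTransportAtTwoRankCertificateLambda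
  Summit.BirchSwinnertonDyer.BirchSwinnertonDyer.Theorems.AlignedTransportAtTwoKilfordStratumShared

variable (W : WeierstrassCurve ℚ) [W.IsElliptic]

/-! ## §1 The `S₃`-closure over the resolvent: `ℚ(δ) ≤ ℚ(W[2])`, `[ℚ(W[2]) : ℚ(δ)] ∣ 3` -/

/-- **`ℚ(√Δ_W) ⊆ ℚ(W[2])`**: for `δ ∈ ℚ̄` with `δ² = Δ_W`, `δ = ±4δ₀` with `δ₀ = ∏_{i<j}(x_i − x_j)` built from the `2`-torsion abscissae
(`16 δ₀² = Δ`, tree `sixteen_mul_delta_sq`; `x_i ∈ ℚ(W[2])`, tree `xT_mem_divisionField`). [cite: DokchitserDokchitserMathZ2012, Theorem (1), proof (ℚ(E[2]) ⊃ ℚ(√Δ))]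
[cite: SilvermanAEC2009, III.§1 (b₂, b₄, b₆, Δ) and VIII.§1] -/
theorem adjoin_le_divisionField_two_of_sq_eq {δ : AlgebraicClosure ℚ} (hδ : δ ^ 2 = ((W.Δ : ℚ) : AlgebraicClosure ℚ)) :
    ℚ⟮δ⟯ ≤ W.divisionField 2 := by
  have h2 : (2 : ℚ) ≠ 0 := two_ne_zero
  refine adjoin_simple_le_iff.mpr ?_
  have hd : delta W h2 ∈ W.divisionField 2 := by
    change (xT W h2 0 - xT W h2 1) * (xT W h2 0 - xT W h2 2) * (xT W h2 1 - xT W h2 2) ∈ W.divisionField 2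
    exact mul_mem (mul_mem (sub_mem (xT_mem_divisionField W h2 0) (xT_mem_divisionField W h2 1))
      (sub_mem (xT_mem_divisionField W h2 0) (xT_mem_divisionField W h2 2)))
      (sub_mem (xT_mem_divisionField W h2 1) (xT_mem_divisionField W h2 2))
  have hsq : δ ^ 2 = (4 * delta W h2) ^ 2 := by
    have h16 := sixteen_mul_delta_sq W h2
    rw [eq_ratCast] at h16
    rw [hδ, ← h16]; ring
  have h4 : (4 : AlgebraicClosure ℚ) ∈ W.divisionField 2 := ofNat_mem _ 4
  rcases sq_eq_sq_iff_eq_or_eq_neg.mp hsq with h | h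
  · rw [h]; exact mul_mem h4 hd
  · rw [h]; exact neg_mem (mul_mem h4 hd)

/-- **`ℚ(W[2])` is Galois over `ℚ(√Δ_W)` of degree dividing `3`** (`Δ_W ∉ ℚ²`: `[ℚ(δ):ℚ] = 2`, `[ℚ(W[2]):ℚ] ∣ 6`; the algebra structure is the
inclusion `ℚ(δ) ≤ ℚ(W[2])` of §1). [cite: DokchitserDokchitserMathZ2012, Theorem (1), proof] [cite: SilvermanAEC2009, VIII.§1] -/
theorem finrank_divisionField_two_dvd_three_of_sq_eq (hΔ : ¬ IsSquare W.Δ) {δ : AlgebraicClosure ℚ}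
    (hδ : δ ^ 2 = ((W.Δ : ℚ) : AlgebraicClosure ℚ)) :
    letI : Algebra ℚ⟮δ⟯ (W.divisionField 2) := (IntermediateField.inclusion (adjoin_le_divisionField_two_of_sq_eq W hδ)).toRingHom.toAlgebra
    IsGalois ℚ⟮δ⟯ (W.divisionField 2) ∧ Module.finrank ℚ⟮δ⟯ (W.divisionField 2) ∣ 3 := by
  have hK := adjoin_le_divisionField_two_of_sq_eq W hδ
  letI algK : Algebra ℚ⟮δ⟯ (W.divisionField 2) := (IntermediateField.inclusion hK).toRingHom.toAlgebra
  haveI : IsScalarTower ℚ ℚ⟮δ⟯ (W.divisionField 2) :=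
    IsScalarTower.of_algebraMap_eq fun q => ((IntermediateField.inclusion hK).commutes q).symm
  haveI : IsGalois ℚ (W.divisionField 2) := W.isGalois_divisionField 2
  have hδint : IsIntegral ℚ δ := ((AlgebraicClosure.isAlgebraic ℚ).isAlgebraic δ).isIntegral
  haveI : FiniteDimensional ℚ ℚ⟮δ⟯ := IntermediateField.adjoin.finiteDimensional hδint
  haveI : IsGalois ℚ⟮δ⟯ (W.divisionField 2) := IsGalois.tower_top_of_isGalois ℚ ℚ⟮δ⟯ (W.divisionField 2)
  refine ⟨inferInstance, ?_⟩
  have hK2 : Module.finrank ℚ ℚ⟮δ⟯ = 2 := finrank_adjoin_eq_two_of_sq_eq hδ hΔ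
  have hmul := Module.finrank_mul_finrank ℚ ℚ⟮δ⟯ (W.divisionField 2)
  have h6 := AddKatoTwo.finrank_divisionField_two_dvd_six W
  rw [hK2] at hmul
  have : 2 * Module.finrank ℚ⟮δ⟯ (W.divisionField 2) ∣ 2 * 3 := by rw [hmul]; exact h6
  exact Nat.dvd_of_mul_dvd_mul_left two_pos this

/-! ## §2 Layer `0`: `ord₂ h` and `rank₂ Cl` of `ℚ(W[2])` versus `ℚ(√Δ_W)` -/

/-- ★ **`ord₂ h(ℚ(W[2])) ≡ ord₂ h(ℚ(√Δ_W)) (mod 2)` and `ord₂ h(ℚ(√Δ_W)) ≤ ord₂ h(ℚ(W[2]))`** for EVERY elliptic `W/ℚ` with `Δ_W ∉ ℚ²` (`δ² = Δ_W`):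
the `2`-part of `h(ℚ(W[2]))/h(ℚ(√Δ_W))` is a power of `4` (coprime Galois descent + orbit counting of `Gal(ℚ(W[2])/ℚ(δ))`, a `3`-group).
[cite: Washington1997, §10.1 and Thm. 10.8] [cite: NeukirchANT1999, Ch. III §1 Prop. (1.6) (ii), (iv)] -/
theorem padicValNat_two_card_classGroup_divisionField_two_modEq_two (hΔ : ¬ IsSquare W.Δ) {δ : AlgebraicClosure ℚ}
    (hδ : δ ^ 2 = ((W.Δ : ℚ) : AlgebraicClosure ℚ)) [NumberField ℚ⟮δ⟯] [NumberField (W.divisionField 2)] :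
    padicValNat 2 (Nat.card (ClassGroup (𝓞 (W.divisionField 2)))) ≡ padicValNat 2 (Nat.card (ClassGroup (𝓞 ℚ⟮δ⟯))) [MOD 2] ∧
      padicValNat 2 (Nat.card (ClassGroup (𝓞 ℚ⟮δ⟯))) ≤ padicValNat 2 (Nat.card (ClassGroup (𝓞 (W.divisionField 2)))) := by
  have hK := adjoin_le_divisionField_two_of_sq_eq W hδ
  letI algK : Algebra ℚ⟮δ⟯ (W.divisionField 2) := (IntermediateField.inclusion hK).toRingHom.toAlgebra
  obtain ⟨hG, h3⟩ := finrank_divisionField_two_dvd_three_of_sq_eq W hΔ hδ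
  haveI := hG
  haveI : Fact (Nat.Prime 2) := ⟨Nat.prime_two⟩
  haveI : Fact (Nat.Prime 3) := ⟨Nat.prime_three⟩
  refine ⟨padicValNat_two_card_classGroup_modEq_two_of_finrank_dvd_three ℚ⟮δ⟯ (W.divisionField 2) h3,
    padicValNat_card_classGroup_le_of_not_dvd_finrank ℚ⟮δ⟯ (W.divisionField 2)
      (not_dvd_finrank_of_isPGroup ℚ⟮δ⟯ (W.divisionField 2) (isPGroup_three_of_finrank_dvd_three ℚ⟮δ⟯ (W.divisionField 2) h3)
        (by norm_num))⟩

/-- ★ **`rank₂ Cl(ℚ(W[2])) ≡ rank₂ Cl(ℚ(√Δ_W)) (mod 2)` and `rank₂ Cl(ℚ(√Δ_W)) ≤ rank₂ Cl(ℚ(W[2]))`** (`rank₂ M = ord₂ #(M/M²)`) for every elliptic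
`W/ℚ` with `Δ_W ∉ ℚ²`.  The right side is Gauss's genus number of the quadratic field `ℚ(√Δ_W)`, so a census value `rank₂ Cl(ℚ(W[2])) = r₀` must have the
parity of `t − 1` (`t` = number of primes ramified in `ℚ(√Δ_W)`). [cite: Washington1997, Thm. 10.8] [cite: NeukirchANT1999, Ch. III §1 Prop. (1.6) (ii), (iv)] -/
theorem rankTwo_classGroup_divisionField_two_modEq_two (hΔ : ¬ IsSquare W.Δ) {δ : AlgebraicClosure ℚ}
    (hδ : δ ^ 2 = ((W.Δ : ℚ) : AlgebraicClosure ℚ)) [NumberField ℚ⟮δ⟯] [NumberField (W.divisionField 2)] :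
    padicValNat 2 (Nat.card (ClassGroup (𝓞 (W.divisionField 2)) ⧸ (powMonoidHom 2 : ClassGroup (𝓞 (W.divisionField 2)) →* _).range)) ≡
        padicValNat 2 (Nat.card (ClassGroup (𝓞 ℚ⟮δ⟯) ⧸ (powMonoidHom 2 : ClassGroup (𝓞 ℚ⟮δ⟯) →* _).range)) [MOD 2] ∧
      padicValNat 2 (Nat.card (ClassGroup (𝓞 ℚ⟮δ⟯) ⧸ (powMonoidHom 2 : ClassGroup (𝓞 ℚ⟮δ⟯) →* _).range)) ≤
        padicValNat 2 (Nat.card (ClassGroup (𝓞 (W.divisionField 2)) ⧸ (powMonoidHom 2 : ClassGroup (𝓞 (W.divisionField 2)) →* _).range)) := by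
  have hK := adjoin_le_divisionField_two_of_sq_eq W hδ
  letI algK : Algebra ℚ⟮δ⟯ (W.divisionField 2) := (IntermediateField.inclusion hK).toRingHom.toAlgebra
  obtain ⟨hG, h3⟩ := finrank_divisionField_two_dvd_three_of_sq_eq W hΔ hδ
  haveI := hG
  haveI : Fact (Nat.Prime 2) := ⟨Nat.prime_two⟩
  haveI : Fact (Nat.Prime 3) := ⟨Nat.prime_three⟩
  refine ⟨padicValNat_two_card_quotient_sq_modEq_two_of_finrank_dvd_three ℚ⟮δ⟯ (W.divisionField 2) h3,
    padicValNat_card_quotient_pow_le_of_not_dvd_finrank ℚ⟮δ⟯ (W.divisionField 2)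
      (not_dvd_finrank_of_isPGroup ℚ⟮δ⟯ (W.divisionField 2) (isPGroup_three_of_finrank_dvd_three ℚ⟮δ⟯ (W.divisionField 2) h3)
        (by norm_num))⟩

/-! ## §3 The cyclotomic `ℤ₂`-towers of `ℚ(W[2])` and `ℚ(√Δ_W)`: parity of `e_n`, `rank₂`, `λ₂` -/

/-- ★ **`e_n(ℚ(W[2])) ≡ e_n(ℚ(√Δ_W)) (mod 2)` and `e_n(ℚ(√Δ_W)) ≤ e_n(ℚ(W[2]))` at EVERY layer `n`** of the cyclotomic `ℤ₂`-towers (`κ`, `κT` any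
cyclotomic `ℤ₂`-extensions of `ℚ(δ)`, `ℚ(W[2])`; `e_n = ord₂ h` of the `n`-th layer), for every elliptic `W/ℚ` with `Δ_W ∉ ℚ²`.
[cite: Washington1997, Thm. 10.8 and §13.1] [cite: Iwasawa1973MuInvariants, §3] -/
theorem classNumberPExp_divisionField_two_modEq_two_resolvent (hΔ : ¬ IsSquare W.Δ) {δ : AlgebraicClosure ℚ}
    (hδ : δ ^ 2 = ((W.Δ : ℚ) : AlgebraicClosure ℚ)) (κ : ZpExtension ℚ⟮δ⟯ 2) (hκ : κ.IsCyclotomic)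
    (κT : ZpExtension (W.divisionField 2) 2) (hκT : κT.IsCyclotomic) (n : ℕ) :
    classNumberPExp κT n ≡ classNumberPExp κ n [MOD 2] ∧ classNumberPExp κ n ≤ classNumberPExp κT n := by
  have hK := adjoin_le_divisionField_two_of_sq_eq W hδ
  letI algK : Algebra ℚ⟮δ⟯ (W.divisionField 2) := (IntermediateField.inclusion hK).toRingHom.toAlgebra
  obtain ⟨hG, h3⟩ := finrank_divisionField_two_dvd_three_of_sq_eq W hΔ hδ
  haveI := hG
  have hδint : IsIntegral ℚ δ := ((AlgebraicClosure.isAlgebraic ℚ).isAlgebraic δ).isIntegral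
  haveI : FiniteDimensional ℚ ℚ⟮δ⟯ := IntermediateField.adjoin.finiteDimensional hδint
  haveI : NumberField ℚ⟮δ⟯ := NumberField.mk
  haveI : NumberField (W.divisionField 2) := NumberField.mk
  haveI : Fact (Nat.Prime 2) := ⟨Nat.prime_two⟩
  exact (classNumberPExp_classGroupPRank_modEq_two_of_isCyclotomic_of_finrank_dvd_three (W.divisionField 2) h3 κ hκ κT hκT n).1

/-- ★ **`rank₂ Cl(ℚ(W[2])_n) ≡ rank₂ Cl(ℚ(√Δ_W)_n) (mod 2)` and `≤` at EVERY layer `n`** of the cyclotomic `ℤ₂`-towers, for every elliptic `W/ℚ` with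
`Δ_W ∉ ℚ²`.  In particular a 2-RANK CERTIFICATE `rank₂ Cl(T_{n+1}) = rank₂ Cl(T_n) = r` on the sextic (g27/g28) has `r ≡ rank₂ Cl(ℚ(√Δ_W)_n) (mod 2)`.
[cite: Washington1997, Thm. 10.8 and §13.1] -/
theorem classGroupPRank_divisionField_two_modEq_two_resolvent (hΔ : ¬ IsSquare W.Δ) {δ : AlgebraicClosure ℚ}
    (hδ : δ ^ 2 = ((W.Δ : ℚ) : AlgebraicClosure ℚ)) (κ : ZpExtension ℚ⟮δ⟯ 2) (hκ : κ.IsCyclotomic)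
    (κT : ZpExtension (W.divisionField 2) 2) (hκT : κT.IsCyclotomic) (n : ℕ) :
    classGroupPRank κT n ≡ classGroupPRank κ n [MOD 2] ∧ classGroupPRank κ n ≤ classGroupPRank κT n := by
  have hK := adjoin_le_divisionField_two_of_sq_eq W hδ
  letI algK : Algebra ℚ⟮δ⟯ (W.divisionField 2) := (IntermediateField.inclusion hK).toRingHom.toAlgebra
  obtain ⟨hG, h3⟩ := finrank_divisionField_two_dvd_three_of_sq_eq W hΔ hδ
  haveI := hG
  have hδint : IsIntegral ℚ δ := ((AlgebraicClosure.isAlgebraic ℚ).isAlgebraic δ).isIntegral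
  haveI : FiniteDimensional ℚ ℚ⟮δ⟯ := IntermediateField.adjoin.finiteDimensional hδint
  haveI : NumberField ℚ⟮δ⟯ := NumberField.mk
  haveI : NumberField (W.divisionField 2) := NumberField.mk
  haveI : Fact (Nat.Prime 2) := ⟨Nat.prime_two⟩
  exact (classNumberPExp_classGroupPRank_modEq_two_of_isCyclotomic_of_finrank_dvd_three (W.divisionField 2) h3 κ hκ κT hκT n).2

/-- ★ **`λ₂(ℚ(W[2])) ≡ λ₂(ℚ(√Δ_W)) (mod 2)`**: for every elliptic `W/ℚ` with `Δ_W ∉ ℚ²` and any cyclotomic `ℤ₂`-extensions `κ`, `κT` of `ℚ(δ)`, `ℚ(W[2])`: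
`μ₂(ℚ(W[2])) = 0` (the C2 input, growth form) ⟹ `μ₂(ℚ(√Δ_W)) = 0`, `λ₂(ℚ(√Δ_W)) ≤ λ₂(ℚ(W[2]))` and `λ₂(ℚ(W[2])) ≡ λ₂(ℚ(√Δ_W)) (mod 2)`
(`classicalLambda`, the slope of the growth law). [cite: Washington1997, Thm. 10.8 and §13.3 Thm. 13.13] [cite: Iwasawa1973MuInvariants, §3] -/
theorem classicalLambda_divisionField_two_modEq_two_resolvent (hΔ : ¬ IsSquare W.Δ) {δ : AlgebraicClosure ℚ}
    (hδ : δ ^ 2 = ((W.Δ : ℚ) : AlgebraicClosure ℚ)) (κ : ZpExtension ℚ⟮δ⟯ 2) (hκ : κ.IsCyclotomic)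
    (κT : ZpExtension (W.divisionField 2) 2) (hκT : κT.IsCyclotomic) (hμ : ClassicalMuVanishes κT) :
    ClassicalMuVanishes κ ∧ classicalLambda κ ≤ classicalLambda κT ∧ classicalLambda κT ≡ classicalLambda κ [MOD 2] := by
  have hK := adjoin_le_divisionField_two_of_sq_eq W hδ
  letI algK : Algebra ℚ⟮δ⟯ (W.divisionField 2) := (IntermediateField.inclusion hK).toRingHom.toAlgebra
  obtain ⟨hG, h3⟩ := finrank_divisionField_two_dvd_three_of_sq_eq W hΔ hδ
  haveI := hG
  have hδint : IsIntegral ℚ δ := ((AlgebraicClosure.isAlgebraic ℚ).isAlgebraic δ).isIntegral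
  haveI : FiniteDimensional ℚ ℚ⟮δ⟯ := IntermediateField.adjoin.finiteDimensional hδint
  haveI : NumberField ℚ⟮δ⟯ := NumberField.mk
  haveI : NumberField (W.divisionField 2) := NumberField.mk
  haveI : Fact (Nat.Prime 2) := ⟨Nat.prime_two⟩
  exact classicalLambda_modEq_two_of_isCyclotomic_of_finrank_dvd_three (W.divisionField 2) h3 κ hκ κT hκT hμ

/-! ## §4 The Kilford sub-cell (`Δ_W < 0`, ON the stratum): the parity bit of the rank certificate -/

/-- ★ **The rank certificate's λ-reading WITH its parity bit.**  `W/ℚ` elliptic, no rational `2`-torsion abscissa, `Δ_W < 0`, ON the Kilford stratum; `κT`, `κ`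
any cyclotomic `ℤ₂`-extensions of `ℚ(W[2])`, `ℚ(√Δ_W)`; a 2-RANK CERTIFICATE `rank₂ Cl(T_{n+1}) = rank₂ Cl(T_n)` on the sextic.  Then: `μ₂ = 0` on both towers,
**`3 ≤ λ₂(ℚ(W[2])) ≤ rank₂ Cl(T_n)`** (g28), **`1 ≤ λ₂(ℚ(√Δ_W)) ≤ λ₂(ℚ(W[2]))`** (g26 + §3) and **`λ₂(ℚ(W[2])) ≡ λ₂(ℚ(√Δ_W)) (mod 2)`** (§3).
[cite: Fukuda1994, Thm. 1 (2), p. 264] [cite: Washington1997, Thm. 10.8, §13.3 Thm. 13.13] [cite: Lang1990, Ch. 13 §4 Lemma 4.1] -/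
theorem classicalLambda_sandwich_and_parity_of_rankCert (ht : ∀ x : ℚ, ¬ HasRationalTwoTorsionX W x) (hΔ : W.Δ < 0)
    (hs : OnKilfordStratumAtTwo W) {δ : AlgebraicClosure ℚ} (hδ : δ ^ 2 = ((W.Δ : ℚ) : AlgebraicClosure ℚ))
    (κ : ZpExtension ℚ⟮δ⟯ 2) (hκ : κ.IsCyclotomic) (κT : ZpExtension (W.divisionField 2) 2) (hκT : κT.IsCyclotomic)
    {n : ℕ} (hcert : classGroupPRank κT (n + 1) = classGroupPRank κT n) :
    (ClassicalMuVanishes κT ∧ 3 ≤ classicalLambda κT ∧ classicalLambda κT ≤ classGroupPRank κT n) ∧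
      (ClassicalMuVanishes κ ∧ 1 ≤ classicalLambda κ ∧ classicalLambda κ ≤ classicalLambda κT) ∧
        classicalLambda κT ≡ classicalLambda κ [MOD 2] := by
  have hsq : ¬ IsSquare W.Δ := fun ⟨r, hr⟩ ↦ by nlinarith [mul_self_nonneg r]
  obtain ⟨hμT, h3, hle⟩ := three_le_classicalLambda_and_le_of_rankCert_divisionField_two W ht hΔ hs κT hκT hcert
  obtain ⟨hμ, hlel, hpar⟩ := classicalLambda_divisionField_two_modEq_two_resolvent W hsq hδ κ hκ κT hκT hμT
  have h1 : 1 ≤ classicalLambda κ := (classicalMuVanishes_iff_one_le_classicalLambda_resolvent W hΔ hs hδ κ hκ).mp hμ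
  exact ⟨⟨hμT, h3, hle⟩, ⟨hμ, h1, hlel⟩, hpar⟩

/-- **A certificate of the minimal value `3` forces `λ₂(ℚ(√Δ_W))` to be ODD, hence `∈ {1, 3}`** (`λ₂(T) = 3`, g28 `classicalLambda_eq_three_of_rankCert_eq_three…`,
and `1 ≤ λ₂(ℚ(√Δ_W)) ≤ λ₂(T)` with the same parity).  Kilford sub-cell, hypotheses as above.
[cite: Fukuda1994, Thm. 1 (2), p. 264] [cite: Washington1997, Thm. 10.8 and §13.3 Thm. 13.13] -/
theorem classicalLambda_resolvent_eq_one_or_three_of_rankCert_eq_three (ht : ∀ x : ℚ, ¬ HasRationalTwoTorsionX W x) (hΔ : W.Δ < 0)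
    (hs : OnKilfordStratumAtTwo W) {δ : AlgebraicClosure ℚ} (hδ : δ ^ 2 = ((W.Δ : ℚ) : AlgebraicClosure ℚ))
    (κ : ZpExtension ℚ⟮δ⟯ 2) (hκ : κ.IsCyclotomic) (κT : ZpExtension (W.divisionField 2) 2) (hκT : κT.IsCyclotomic)
    {n : ℕ} (hcert : classGroupPRank κT (n + 1) = classGroupPRank κT n) (h3 : classGroupPRank κT n = 3) :
    classicalLambda κT = 3 ∧ (classicalLambda κ = 1 ∨ classicalLambda κ = 3) := by
  have hT3 := classicalLambda_eq_three_of_rankCert_eq_three_divisionField_two W ht hΔ hs κT hκT hcert h3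
  obtain ⟨-, ⟨-, h1, hle⟩, hpar⟩ := classicalLambda_sandwich_and_parity_of_rankCert W ht hΔ hs hδ κ hκ κT hκT hcert
  rw [hT3] at hle hpar
  refine ⟨hT3, ?_⟩
  have hmod : 3 % 2 = classicalLambda κ % 2 := hpar
  omega

/-- **If `λ₂(ℚ(√Δ_W))` is EVEN, no 2-rank certificate of value `3` exists on the sextic** (Kilford sub-cell): a certificate of value `r` at `(n, n+1)` has
`r ≥ λ₂(T) ≥ 3` with `λ₂(T)` even, so `r ≥ 4`.  The parity of `λ₂` of the imaginary quadratic `ℚ(√Δ_W)` (Ferrero 1980 / Kida 1979, closed form) thus raises the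
first admissible certificate value from `3` to `4` on half of the sub-cell. [cite: Fukuda1994, Thm. 1 (2), p. 264] [cite: Washington1997, Thm. 10.8 and §13.3 Thm. 13.13] -/
theorem four_le_classGroupPRank_of_rankCert_of_even_classicalLambda_resolvent (ht : ∀ x : ℚ, ¬ HasRationalTwoTorsionX W x) (hΔ : W.Δ < 0)
    (hs : OnKilfordStratumAtTwo W) {δ : AlgebraicClosure ℚ} (hδ : δ ^ 2 = ((W.Δ : ℚ) : AlgebraicClosure ℚ))
    (κ : ZpExtension ℚ⟮δ⟯ 2) (hκ : κ.IsCyclotomic) (κT : ZpExtension (W.divisionField 2) 2) (hκT : κT.IsCyclotomic)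
    (heven : Even (classicalLambda κ)) {n : ℕ} (hcert : classGroupPRank κT (n + 1) = classGroupPRank κT n) :
    4 ≤ classicalLambda κT ∧ 4 ≤ classGroupPRank κT n := by
  obtain ⟨⟨-, h3, hle⟩, -, hpar⟩ := classicalLambda_sandwich_and_parity_of_rankCert W ht hΔ hs hδ κ hκ κT hκT hcert
  have hmod : classicalLambda κT % 2 = classicalLambda κ % 2 := hpar
  obtain ⟨m, hm⟩ := heven
  constructor <;> omega

/-- The same with the stratum condition in its kernel-decided form `Δ_min ≡ 1 (mod 8)` (`W` good ordinary at `2`; tree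
`onKilfordStratumAtTwo_iff_minimalDiscriminantInt_emod_eight`): certificate ⟹ `3 ≤ λ₂(T) ≤ r`, `1 ≤ λ₂(ℚ(√Δ_W)) ≤ λ₂(T)`, same parity.
[cite: Fukuda1994, Thm. 1 (2), p. 264] [cite: Serre1973, Ch. II §3.3 Thm. 4] [cite: Washington1997, Thm. 10.8] -/
theorem classicalLambda_sandwich_and_parity_of_rankCert_of_minimalDiscriminantInt_emod_eight [W.IsGloballyMinimal] (hord : IsOrdinaryAt W 2)
    (ht : ∀ x : ℚ, ¬ HasRationalTwoTorsionX W x) (hΔ : W.Δ < 0) (h8 : minimalDiscriminantInt W % 8 = 1)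
    {δ : AlgebraicClosure ℚ} (hδ : δ ^ 2 = ((W.Δ : ℚ) : AlgebraicClosure ℚ))
    (κ : ZpExtension ℚ⟮δ⟯ 2) (hκ : κ.IsCyclotomic) (κT : ZpExtension (W.divisionField 2) 2) (hκT : κT.IsCyclotomic)
    {n : ℕ} (hcert : classGroupPRank κT (n + 1) = classGroupPRank κT n) :
    (ClassicalMuVanishes κT ∧ 3 ≤ classicalLambda κT ∧ classicalLambda κT ≤ classGroupPRank κT n) ∧
      (ClassicalMuVanishes κ ∧ 1 ≤ classicalLambda κ ∧ classicalLambda κ ≤ classicalLambda κT) ∧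
        classicalLambda κT ≡ classicalLambda κ [MOD 2] :=
  classicalLambda_sandwich_and_parity_of_rankCert W ht hΔ
    ((onKilfordStratumAtTwo_iff_minimalDiscriminantInt_emod_eight W hord).mpr h8) hδ κ hκ κT hκT hcert

end Summit.BirchSwinnertonDyer.BirchSwinnertonDyer.Theorems.AlignedTransportAtTwoResolventParity

end
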